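import Literature.NumberTheory.Automorphic.CDTTheorem722
import Literature.NumberTheory.Automorphic.CDTTheorem712
import Literature.NumberTheory.Automorphic.BCDTModularity
import Literature.NumberTheory.Automorphic.BCDTModularityModPProofs
import Literature.NumberTheory.Automorphic.HeckeAlgebraOfTypeSigma
import Literature.NumberTheory.EllipticCurves.FramedTateGaloisRep
import Literature.NumberTheory.EllipticCurves.FrobeniusTraceBaseChange
import Literature.NumberTheory.EllipticCurves.FrobeniusTateModuleProofs
import Literature.NumberTheory.EllipticCurves.TateModuleFreeProofs
import Literature.NumberTheory.EllipticCurves.TateModuleFinrankProofs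
import Literature.NumberTheory.EllipticCurves.GreenbergSelmerOrdinaryFiltrationProofs
import Literature.NumberTheory.EllipticCurves.NewformGaloisRepModLOfPadicAlgClProofs
import Literature.NumberTheory.GaloisRepresentations.StableLatticeValuationRing
import Literature.NumberTheory.GaloisRepresentations.FramedRepBaseChange
import Literature.NumberTheory.GaloisRepresentations.ResidualGaloisRep
import Literature.NumberTheory.DiophantineGeometry.Conductor
import Literature.FieldTheory.AlgClosed.PadicAlgClEquivComplex
import HarnessLib

/-!
# Stub-ideation k = 2, GENERATION 9 (home family 2 = RESHAPE) for `stub_liftFive` of crux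
# `FreyModularity` (stmt-ABC-11340, route ABC/DefiniteXi, line `Lines/Sketch.lean` sha 21576c53)

Companion of `STUB-IDEAS-stub_liftFive-2.md` (gen 9).  Gen 8 (`StubIdeas.LiftFive2g8`, rc 0)
re-centred DDT's carrier `N_Σ^{ss}` at the `5`-adic Tate module of the SWITCH curve `W'` and cut
the curve-input lifting stub `LiftFiveFromCurve` into the adapters E0 `EntrySelfMemberFive`,
H2 `CongrOfSharedFiveTorsion`, H3 `DetEqFramedTateFive`, gen 7's EXIT `ExitFive`, and ONE debt
X′ `MLTTateSemistableFive'` (`liftFiveFromCurve_of_pieces`, `caseB_of_pieces`, PROVED there).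

Gen 9 makes the family-2 move **weaken → bootstrap** on the adapters themselves: prove each for
the LOSSY object first (the RATIONAL canonical frame `W.framedTateGaloisRep 5 : Γ_ℚ → GL₂(ℚ̄₅)`,
for which the tree already PROVES attachment-type statements: `IsModular.isModularGaloisRepTate`,
`charpoly_framedTateGaloisRep_apply`, `IsTorsionGaloisRep.charpoly_eq_map_charpoly_galoisRepTate`,
`det_galoisRepTate_eq_cyclotomicCharacter_holds`), then remove the loss (integrality over `ℤ̄₅`)
with the tree's stable-lattice theorem `exists_integralModel_of_valuationSubring` and pure
transport (`FramedRep.charpoly_baseChange`, `Matrix.charpoly_units_conj`, `IsGaloisRepOfNewform1.int`).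
Outcome, kernel-checked below:

* **H2 and H3 are PROVED outright** (`congrOfSharedFiveTorsion_holds`, `detEqFramedTateFive_holds`).
* **E0 is reduced to three XS–S micro-lemmas** M2 `RationalAttachmentFive` (the canonical frame of a
  modular curve is attached to the `Γ₁`-lift of its newform — the first bullet of the tree's PROVED
  `IsNewformOf.exists_isGaloisRepOfNewform1_rationalTate`, restated for the canonical frame),
  M3 `HeckePolyIntegralOfCurve` (`a_q(E) ∈ ℤ`, `ε = 1`) and M4 `IntTransportFive` (descend an
  attachment along `ℤ̄₅ ⊆ ℚ̄₅`); the other three pieces M1 `IntegralFrameFive` (stable lattice),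
  M5 `SelfMemberOfAttached` (clauses (i)–(iv) of self-membership) and M6 `FrameRelationFive` are
  PROVED, and so is the assembly `entrySelfMemberFive_of_micro`.
* **EXIT is reduced to** O1a `JExtendsFive` (extend `j : 𝓞_g → ℤ̄₅` to `K_g → ℚ̄₅`; `K_g` is a number
  field by the tree's PROVED `numberField_coeffCharField_of_isNewform1`) and O1d `OutAdapterFive`
  (= k1's PROVED `outAdapter_holds`, gen 6), via the PROVED `exitFive_of_micro` (O1b/O1c inside).

So after gen 9 the re-centred line reads: `stub_liftFive`-for-the-consumer ⟸ SwitchPlus (S3⁺) +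
{M2, M3, M4, O1a, O1d: five one-cycle prover targets against NAMED tree theorems} + X′ (the debt).

Nothing here is registered.  NO `sorry`: helper STATEMENTS are `def … : Prop`; every `theorem` is
proved.
-/

noncomputable section

open scoped MatrixGroups Matrix NumberField ModularForm Polynomial Classical NNReal
open NumberField IsDedekindDomain IsDedekindDomain.HeightOneSpectrum Polynomial Filter
open Literature.NumberTheory Literature.NumberTheory.Automorphic Literature.NumberTheory.Automorphic.BCDT
open Literature.NumberTheory.GaloisRepresentations Literature.NumberTheory.GaloisRepresentations.ModPGaloisRep
open Literature.NumberTheory.EllipticCurves Literature.NumberTheory.EllipticCurves.ModularForms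
open CongruenceSubgroup Rat.HeightOneSpectrum WeierstrassCurve Field IsLocalRing

namespace Summit.ABC.ABC.Cruxes.FreyModularity.StubIdeas.LiftFive2g9

universe u v

/-! ### Carrier and the gen-8 adapters (copied VERBATIM from `StubIdeas.LiftFive2g8`, so that this
file is self-contained on the farm) -/

section Carrier

variable (p : ℕ) (k : ℤ) {O : Type u} [CommRing O] [TopologicalSpace O]
  (Ō : Type v) [CommRing Ō] [IsLocalRing Ō] [TopologicalSpace Ō] [Algebra O Ō]
  (ρ : FramedGaloisRep ℚ O 2) (S : Set ℕ)

/-- `N_Σ^{ss}(Ō)` — verbatim `modularLiftsOfTypeSigma` (DFG §3.1) with the level condition `¬ p ∣ M`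
relaxed to `¬ p ^ 2 ∣ M` (DDT Def. 3.25 / Lemma 3.26).  Identical to gen 7/8.
[cite: DarmonDiamondTaylor1995, §3.3 (p. 94)] -/
def modularLiftsOfTypeSigmaSemistable : Set (FramedGaloisRep ℚ Ō 2) :=
  {ρ' | (∃ (M : ℕ) (_ : NeZero M) (g : CuspForm (Gamma1 M) k) (j : coeffCharIntegers g →+* Ō),
          IsNewform1 g ∧ ¬ p ^ 2 ∣ M ∧ IsGaloisRepOfNewform1Int g j {r | r ∣ M * p} ρ') ∧
      (∀ (σ : absoluteGaloisGroup ℚ) (i : ℕ),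
          (FramedRep.charpoly ρ' σ).coeff i - algebraMap O Ō ((FramedRep.charpoly ρ σ).coeff i) ∈
            maximalIdeal Ō) ∧
      (∀ σ : absoluteGaloisGroup ℚ,
          ((ρ' σ : GL (Fin 2) Ō) : Matrix (Fin 2) (Fin 2) Ō).det =
            algebraMap O Ō ((ρ σ : GL (Fin 2) O) : Matrix (Fin 2) (Fin 2) O).det) ∧
      ∀ v : HeightOneSpectrum (𝓞 ℚ), ((primesEquiv v : Nat.Primes) : ℕ) ∉ S →
        ((primesEquiv v : Nat.Primes) : ℕ) ≠ p → ρ'.IsMinimallyRamifiedAt v}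

end Carrier

/-- Gen 7/8's EXIT (verbatim). [folklore] -/
def ExitFive : Prop :=
  ∀ (W : WeierstrassCurve ℚ) [W.IsElliptic] (hf : Continuous (padicAlgClIntegers 5).subtype)
    {M : ℕ} [NeZero M] (g : CuspForm (Gamma1 M) 2)
    (j : coeffCharIntegers g →+* padicAlgClIntegers 5)
    (ρ' : FramedGaloisRep ℚ (padicAlgClIntegers 5) 2) (P : GL (Fin 2) (PadicAlgCl 5)),
    IsNewform1 g → IsGaloisRepOfNewform1Int g j {r | r ∣ M * 5} ρ' →
    FramedRep.conj P (FramedRep.baseChange (padicAlgClIntegers 5).subtype hf ρ') =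
      W.framedTateGaloisRep 5 →
    W.IsModularGaloisRepTate 5

/-- Gen 8's E0 (verbatim). [cite: DiamondShurman2005, Thm. 9.4.1] -/
def EntrySelfMemberFive : Prop :=
  ∀ (W' : WeierstrassCurve ℚ) [W'.IsElliptic] [NeZero (W'.conductorNorm ℤ)],
    BCDT.IsModular W' → ¬ 25 ∣ W'.conductorNorm ℤ →
    ∀ S : Set ℕ, (∀ q : ℕ, q.Prime → q ∣ W'.conductorNorm ℤ → q ≠ 5 → q ∈ S) →
    ∃ ρ₀ : FramedGaloisRep ℚ (padicAlgClIntegers 5) 2,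
      ρ₀ ∈ modularLiftsOfTypeSigmaSemistable 5 2 (padicAlgClIntegers 5) ρ₀ S ∧
      (∀ (σ : absoluteGaloisGroup ℚ) (i : ℕ),
        ((FramedRep.charpoly ρ₀ σ).coeff i : PadicAlgCl 5) =
          (FramedRep.charpoly (W'.framedTateGaloisRep 5) σ).coeff i) ∧
      ∀ σ : absoluteGaloisGroup ℚ,
        (((ρ₀ σ : GL (Fin 2) (padicAlgClIntegers 5)) :
            Matrix (Fin 2) (Fin 2) (padicAlgClIntegers 5)).det : PadicAlgCl 5) =
          ((W'.framedTateGaloisRep 5 σ : GL (Fin 2) (PadicAlgCl 5)) :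
            Matrix (Fin 2) (Fin 2) (PadicAlgCl 5)).det

/-- Gen 8's H2 (verbatim). [folklore] -/
def CongrOfSharedFiveTorsion : Prop :=
  ∀ (W W' : WeierstrassCurve ℚ) [W.IsElliptic] [W'.IsElliptic] (ρ : ModPGaloisRep ℚ (ZMod 5) 2),
    W.IsTorsionGaloisRep 5 ρ → W'.IsTorsionGaloisRep 5 ρ →
    ∀ (σ : absoluteGaloisGroup ℚ) (i : ℕ),
      Valued.v ((FramedRep.charpoly (W'.framedTateGaloisRep 5) σ).coeff i -
        (FramedRep.charpoly (W.framedTateGaloisRep 5) σ).coeff i) < 1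

/-- Gen 8's H3 (verbatim). [cite: SilvermanAEC2009, III.8.3 / V.2 (Weil pairing)] -/
def DetEqFramedTateFive : Prop :=
  ∀ (W W' : WeierstrassCurve ℚ) [W.IsElliptic] [W'.IsElliptic] (σ : absoluteGaloisGroup ℚ),
    ((W'.framedTateGaloisRep 5 σ : GL (Fin 2) (PadicAlgCl 5)) :
        Matrix (Fin 2) (Fin 2) (PadicAlgCl 5)).det =
      ((W.framedTateGaloisRep 5 σ : GL (Fin 2) (PadicAlgCl 5)) :
        Matrix (Fin 2) (Fin 2) (PadicAlgCl 5)).det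

/-! ### T2 (gen 9) — E0 bootstrapped through the rational frame: micro-lemmas M1–M6 -/

/-- **M1 `IntegralFrameFive`** (PROVED below, `integralFrameFive_holds`): the canonical frame of
`V₅ W'` has an integral model over `ℤ̄₅` — a continuous `ρ₀ : Γ_ℚ → GL₂(ℤ̄₅)` with
`P (ρ₀ ⊗ ℚ̄₅) P⁻¹ = ρ_{W',5}`.  Serre's stable lattice for the OPEN valuation ring `ℤ̄₅ ⊆ ℚ̄₅`
(`exists_integralModel_of_valuationSubring`), continuity by `IsInducing.generalLinearGroup_map`
(idiom of `exists_framedGaloisRep_adicCompletionIntegers_integralFrame`).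
[cite: SerreAbelianLadic1968, Ch. I §1.1, Remark 1] -/
def IntegralFrameFive : Prop :=
  ∀ (W' : WeierstrassCurve ℚ) [W'.IsElliptic] (hf : Continuous (padicAlgClIntegers 5).subtype),
    ∃ (ρ₀ : FramedGaloisRep ℚ (padicAlgClIntegers 5) 2) (P : GL (Fin 2) (PadicAlgCl 5)),
      FramedRep.conj P (FramedRep.baseChange (padicAlgClIntegers 5).subtype hf ρ₀) =
        W'.framedTateGaloisRep 5

/-- **M2 `RationalAttachmentFive`** (XS–S, OPEN): the canonical frame `ρ_{W',5}` of a curve with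
newform `f ∈ S₂(Γ₀(N))` is attached (`IsGaloisRepOfNewform1`) to the `Γ₁(N)`-lift `f₁` away from
`N·5`, along any `ι : ℚ̄₅ ≃ ℂ` (the coefficient field of `f₁` is `ℚ`,
`coeffCharField_liftToGamma1_eq_bot`).  Proof = the first bullet of the tree's PROVED
`IsNewformOf.exists_isGaloisRepOfNewform1_rationalTate` with `framedTateGaloisRep` in place of the
anonymous frame: `isUnramifiedAt_framedTateGaloisRep_iff` + `isUnramifiedAt_rationalTateGaloisRepOf_geomPoints`,
`hasFrobCharpolyAt_framedTateGaloisRep_iff` + `hasFrobCharpolyAt_rationalTateGaloisRepOf_of_hasGoodReductionAt`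
(+ `trace_/det_galoisRepTate_frobenius_of_hasGoodReductionAt_holds`, `lFunction_primesEquiv_eq_frobeniusTraceAt`,
`natCard_residueField_adicCompletionIntegers`), `IsNewformOf.dvd_level_iff_dvd_conductorNorm`, and the
6-line (private!) `IsNewformOf.map_heckePolynomial_liftToGamma1` re-derived from `map_heckePolynomial`,
`coe_liftToGamma1_holds`, `nebentypus_liftToGamma1_holds`.  No irreducibility hypothesis is needed.
[cite: SilvermanAEC2009, C.21 Remark 21.3] [cite: DiamondShurman2005, Thm. 9.4.1] -/
def RationalAttachmentFive : Prop :=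
  ∀ (W' : WeierstrassCurve ℚ) [W'.IsElliptic] {N : ℕ} [NeZero N] (f : CuspForm (Gamma0 N) 2),
    IsNewformOf W' f → ∀ ι : PadicAlgCl 5 ≃+* ℂ,
      IsGaloisRepOfNewform1 (liftToGamma1 N 2 f)
        ((ι.symm : ℂ →+* PadicAlgCl 5).comp (algebraMap (coeffCharField (liftToGamma1 N 2 f)) ℂ))
        {q | q ∣ N * 5} (W'.framedTateGaloisRep 5)

/-- **M3 `HeckePolyIntegralOfCurve`** (XS, OPEN): the Hecke polynomials of the `Γ₁(N)`-lift of the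
newform of a curve lift to `𝓞_{f₁}[X]`: `a_q(f₁) = a_q(W') ∈ ℤ` (`IsNewformOf`, `coe_liftToGamma1_holds`)
and `ε(q) q ∈ {0, q}` (`nebentypus_liftToGamma1_holds`, `MulChar.one_apply` / `map_nonunit`); integers
are integral (`isIntegral_algebraMap`).  (The general newform version is the tree's NAMED fact
`IsNewform1.exists_map_eq_heckePolynomial`, Shimura 3.48 — not needed here.) [cite: Shimura1971, Thm. 3.48] -/
def HeckePolyIntegralOfCurve : Prop :=
  ∀ (W' : WeierstrassCurve ℚ) {N : ℕ} [NeZero N] (f : CuspForm (Gamma0 N) 2), IsNewformOf W' f →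
    ∀ q : ℕ, ∃ P : Polynomial (coeffCharIntegers (liftToGamma1 N 2 f)),
      P.map (algebraMap (coeffCharIntegers (liftToGamma1 N 2 f))
          (coeffCharField (liftToGamma1 N 2 f))) =
        heckePolynomial (liftToGamma1 N 2 f) q

/-- **M4 `IntTransportFive`** (S, OPEN): descend an attachment along `ℤ̄₅ ⊆ ℚ̄₅`.  If
`P (ρ₀ ⊗ ℚ̄₅) P⁻¹` is attached to `g` via `ι' : K_g → ℚ̄₅` away from `S` and the Hecke polynomials are
integral, then `ρ₀` is attached over `ℤ̄₅` via the restriction `j : 𝓞_g → ℤ̄₅` of `ι'`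
(`mem_padicAlgClIntegers_of_isIntegral` builds `j`; `isGaloisRepOfNewform1_conj P⁻¹`,
`IsGaloisRepOfNewform1.int`, then `FramedGaloisRep.isUnramifiedAt_baseChange_iff` /
`hasFrobCharpolyAt_baseChange_iff` with `Subtype.val_injective` and `Polynomial.map_map`).
[cite: DeligneSerre1974, §6] -/
def IntTransportFive : Prop :=
  ∀ (hf : Continuous (padicAlgClIntegers 5).subtype) {M : ℕ} [NeZero M] (g : CuspForm (Gamma1 M) 2)
    (ι' : coeffCharField g →+* PadicAlgCl 5) (S : Set ℕ)
    (ρ₀ : FramedGaloisRep ℚ (padicAlgClIntegers 5) 2) (P : GL (Fin 2) (PadicAlgCl 5)),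
    (∀ q : ℕ, ∃ Q : Polynomial (coeffCharIntegers g),
        Q.map (algebraMap (coeffCharIntegers g) (coeffCharField g)) = heckePolynomial g q) →
    IsGaloisRepOfNewform1 g ι' S
      (FramedRep.conj P (FramedRep.baseChange (padicAlgClIntegers 5).subtype hf ρ₀)) →
    ∃ j : coeffCharIntegers g →+* padicAlgClIntegers 5,
      (padicAlgClIntegers 5).subtype.comp j =
          ι'.comp (algebraMap (coeffCharIntegers g) (coeffCharField g)) ∧
        IsGaloisRepOfNewform1Int g j S ρ₀

/-- **M5 `SelfMemberOfAttached`** (PROVED below, `selfMemberOfAttached_holds`): an integral frame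
attached over `ℤ̄₅` to a newform `g` of level `N_{W'}`, `25 ∤ N_{W'}`, away from `N_{W'}·5` is a
SELF-member of `N_S^{ss}(ρ₀)` for every `S ⊇ {q prime ∣ N_{W'}, q ≠ 5}`: clauses (ii)/(iii) are
reflexive, clause (iv) is `IsUnramifiedAt.isMinimallyRamifiedAt`. [folklore] -/
def SelfMemberOfAttached : Prop :=
  ∀ (W' : WeierstrassCurve ℚ) [NeZero (W'.conductorNorm ℤ)]
    (g : CuspForm (Gamma1 (W'.conductorNorm ℤ)) 2) (j : coeffCharIntegers g →+* padicAlgClIntegers 5)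
    (ρ₀ : FramedGaloisRep ℚ (padicAlgClIntegers 5) 2) (S : Set ℕ),
    IsNewform1 g → ¬ 25 ∣ W'.conductorNorm ℤ →
    IsGaloisRepOfNewform1Int g j {r | r ∣ W'.conductorNorm ℤ * 5} ρ₀ →
    (∀ q : ℕ, q.Prime → q ∣ W'.conductorNorm ℤ → q ≠ 5 → q ∈ S) →
    ρ₀ ∈ modularLiftsOfTypeSigmaSemistable 5 2 (padicAlgClIntegers 5) ρ₀ S

/-- **M6 `FrameRelationFive`** (PROVED below, `frameRelationFive_holds`): if `P (ρ₀ ⊗ ℚ̄₅) P⁻¹ = ρ`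
then the characteristic polynomials and determinants of `ρ₀` map to those of `ρ`
(`FramedRep.charpoly_baseChange`, `Matrix.charpoly_units_conj`, `RingHom.map_det`,
`Matrix.det_units_conj`). [folklore] -/
def FrameRelationFive : Prop :=
  ∀ (hf : Continuous (padicAlgClIntegers 5).subtype)
    (ρ₀ : FramedGaloisRep ℚ (padicAlgClIntegers 5) 2) (P : GL (Fin 2) (PadicAlgCl 5))
    (ρ : FramedGaloisRep ℚ (PadicAlgCl 5) 2),
    FramedRep.conj P (FramedRep.baseChange (padicAlgClIntegers 5).subtype hf ρ₀) = ρ →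
    (∀ (σ : absoluteGaloisGroup ℚ) (i : ℕ),
        ((FramedRep.charpoly ρ₀ σ).coeff i : PadicAlgCl 5) = (FramedRep.charpoly ρ σ).coeff i) ∧
    ∀ σ : absoluteGaloisGroup ℚ,
        (((ρ₀ σ : GL (Fin 2) (padicAlgClIntegers 5)) :
            Matrix (Fin 2) (Fin 2) (padicAlgClIntegers 5)).det : PadicAlgCl 5) =
          ((ρ σ : GL (Fin 2) (PadicAlgCl 5)) : Matrix (Fin 2) (Fin 2) (PadicAlgCl 5)).det

/-- (PROVED) **M1.** -/
theorem integralFrameFive_holds : IntegralFrameFive := by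
  intro W' _ hf
  have hOopen : IsOpen ((padicAlgClIntegers 5 : ValuationSubring (PadicAlgCl 5)) :
      Set (PadicAlgCl 5)) := Valued.isOpen_valuationSubring _
  obtain ⟨P, ρ₀, hρ₀⟩ :=
    GaloisRepresentations.exists_integralModel_of_valuationSubring (O := padicAlgClIntegers 5) hOopen
      (W'.framedTateGaloisRep 5)
  have hcont : Continuous ρ₀ := by
    have hind : Topology.IsInducing
        (Matrix.GeneralLinearGroup.map (n := Fin 2) (padicAlgClIntegers 5).subtype) :=
      (Topology.IsInducing.subtypeVal : Topology.IsInducing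
        ((padicAlgClIntegers 5).subtype : padicAlgClIntegers 5 → PadicAlgCl 5)).generalLinearGroup_map
    rw [hind.continuous_iff]
    have h1 : (Matrix.GeneralLinearGroup.map (padicAlgClIntegers 5).subtype ∘ ρ₀) =
        fun σ ↦ P⁻¹ * W'.framedTateGaloisRep 5 σ * P := funext fun σ ↦ hρ₀ σ
    rw [h1]
    exact (continuous_const.mul (map_continuous _)).mul continuous_const
  refine ⟨⟨ρ₀, hcont⟩, P, ContinuousMonoidHom.ext fun σ ↦ ?_⟩
  rw [FramedRep.conj_apply, FramedRep.baseChange_apply]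
  change P * Matrix.GeneralLinearGroup.map (padicAlgClIntegers 5).subtype (ρ₀ σ) * P⁻¹ = _
  rw [hρ₀ σ]
  group

/-- (PROVED) **M5.** -/
theorem selfMemberOfAttached_holds : SelfMemberOfAttached := by
  intro W' _ g j ρ₀ S hnew h25 hgal hS
  refine ⟨⟨W'.conductorNorm ℤ, inferInstance, g, j, hnew, ?_, hgal⟩, ?_, ?_, ?_⟩
  · simpa using h25
  · intro σ i
    rw [Algebra.algebraMap_self_apply, sub_self]
    exact zero_mem _
  · intro σ
    rw [Algebra.algebraMap_self_apply]
  · intro v hvS hv5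
    refine ((hgal v ?_).1).isMinimallyRamifiedAt
    intro hv
    simp only [Set.mem_setOf_eq] at hv
    have hq : ((primesEquiv v : Nat.Primes) : ℕ).Prime := (primesEquiv v).2
    rcases (Nat.Prime.dvd_mul hq).mp hv with h | h
    · exact hvS (hS _ hq h hv5)
    · exact hv5 ((Nat.prime_dvd_prime_iff_eq hq (by norm_num)).mp h)

/-- (PROVED) **M6.** -/
theorem frameRelationFive_holds : FrameRelationFive := by
  intro hf ρ₀ P ρ hρ
  subst hρ
  refine ⟨fun σ i ↦ ?_, fun σ ↦ ?_⟩
  · have hc : FramedRep.charpoly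
        (FramedRep.conj P (FramedRep.baseChange (padicAlgClIntegers 5).subtype hf ρ₀)) σ =
        (FramedRep.charpoly ρ₀ σ).map (padicAlgClIntegers 5).subtype := by
      rw [← FramedRep.charpoly_baseChange (padicAlgClIntegers 5).subtype hf ρ₀ σ]
      simp only [FramedRep.charpoly, FramedRep.conj_apply, Units.val_mul, Matrix.coe_units_inv]
      exact Matrix.charpoly_units_conj P _
    rw [hc, Polynomial.coeff_map]
    rfl
  · rw [FramedRep.conj_apply, Units.val_mul, Units.val_mul, Matrix.det_units_conj P,
      FramedRep.coe_baseChange_apply]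
    have h := RingHom.map_det (padicAlgClIntegers 5).subtype
      ((ρ₀ σ : GL (Fin 2) (padicAlgClIntegers 5)) : Matrix (Fin 2) (Fin 2) (padicAlgClIntegers 5))
    exact h

/-- (PROVED, logic) **E0 from the micro-lemmas**: with M1, M5, M6 proved, gen 8's ENTRY
`EntrySelfMemberFive` reduces to M2 + M3 + M4. -/
theorem entrySelfMemberFive_of_micro (h2 : RationalAttachmentFive) (h3 : HeckePolyIntegralOfCurve)
    (h4 : IntTransportFive) : EntrySelfMemberFive := by
  intro W' _ _ hmod h25 S hS
  obtain ⟨f, hf⟩ := hmod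
  have hf' : Continuous (padicAlgClIntegers 5).subtype := continuous_subtype_val
  obtain ⟨ρ₀, P, hconj⟩ := integralFrameFive_holds W' hf'
  obtain ⟨ι⟩ := PadicAlgCl.nonempty_ringEquiv_complex 5
  have hatt := h2 W' f hf ι
  rw [← hconj] at hatt
  obtain ⟨j, -, hgal⟩ := h4 hf' (liftToGamma1 _ 2 f) _ {q | q ∣ W'.conductorNorm ℤ * 5} ρ₀ P
    (h3 W' f hf) hatt
  have hnew : IsNewform1 (liftToGamma1 (W'.conductorNorm ℤ) 2 f) :=
    (isNewform1_liftToGamma1_iff_holds _ 2 f).mpr hf.1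
  obtain ⟨hcoef, hdet⟩ := frameRelationFive_holds hf' ρ₀ P _ hconj
  exact ⟨ρ₀, selfMemberOfAttached_holds W' _ j ρ₀ S hnew h25 hgal hS, hcoef, hdet⟩

/-! ### T2 (gen 9) — H2 and H3 PROVED through the rational frame -/

/-- **H2a** (= k1's H1b, gen 6; re-proved here for self-containedness): the characteristic polynomial
of the canonical frame is `charpoly(σ | T₅ E)` pushed along `ℤ₅ → ℚ₅ → ℚ̄₅`. [folklore] -/
theorem charpoly_framedTateGaloisRep_eq_map_map (W : WeierstrassCurve ℚ) [W.IsElliptic]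
    (σ : absoluteGaloisGroup ℚ) :
    haveI := module_free_tateModule_holds W 5
    haveI := module_finite_tateModule_holds W 5
    FramedRep.charpoly (W.framedTateGaloisRep 5) σ =
      ((W.galoisRepTate 5 σ).charpoly.map (PadicInt.Coe.ringHom (p := 5))).map
        (algebraMap ℚ_[5] (PadicAlgCl 5)) := by
  haveI := module_free_tateModule_holds W 5
  haveI := module_finite_tateModule_holds W 5
  rw [W.charpoly_framedTateGaloisRep_apply 5 σ]
  congr 1
  have hc : (algebraMap ℤ_[5] ℚ_[5] : ℤ_[5] →+* ℚ_[5]) = PadicInt.Coe.ringHom :=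
    RingHom.ext fun _ => rfl
  rw [← hc]
  exact LinearMap.charpoly_baseChange (W.galoisRepTate 5 σ) ℚ_[5]

/-- **H2c** (PROVED): `5`-adic integers congruent modulo `5` are at distance `< 1` in `ℚ̄₅`
(`PadicInt.ker_toZMod`, `PadicInt.mem_nonunits`, `PadicAlgCl.norm_extends`). [folklore] -/
theorem valuation_sub_lt_one_of_toZMod_eq (x y : ℤ_[5]) (h : PadicInt.toZMod x = PadicInt.toZMod y) :
    Valued.v (algebraMap ℚ_[5] (PadicAlgCl 5) (PadicInt.Coe.ringHom (p := 5) x) -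
      algebraMap ℚ_[5] (PadicAlgCl 5) (PadicInt.Coe.ringHom (p := 5) y)) < 1 := by
  rw [← map_sub, ← map_sub]
  have hker : x - y ∈ RingHom.ker (PadicInt.toZMod (p := 5)) := by
    rw [RingHom.mem_ker, map_sub, h, sub_self]
  rw [PadicInt.ker_toZMod] at hker
  have hlt : ‖x - y‖ < 1 := PadicInt.mem_nonunits.mp hker
  have h1 : ‖algebraMap ℚ_[5] (PadicAlgCl 5) (PadicInt.Coe.ringHom (p := 5) (x - y))‖ < 1 := by
    change ‖((((x - y : ℤ_[5]) : ℚ_[5])) : PadicAlgCl 5)‖ < 1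
    rw [PadicAlgCl.norm_extends, ← PadicInt.norm_def]
    exact hlt
  rw [PadicAlgCl.valuation_def, ← NNReal.coe_lt_coe, coe_nnnorm, NNReal.coe_one]
  exact h1

/-- (PROVED) **H2 `CongrOfSharedFiveTorsion`**: H2a + the tree's all-`σ` reduction lemma
`IsTorsionGaloisRep.charpoly_eq_map_charpoly_galoisRepTate` (`charpoly ρ̄(σ) = charpoly(σ | T₅E) mod 5`)
for BOTH curves + H2c. -/
theorem congrOfSharedFiveTorsion_holds : CongrOfSharedFiveTorsion := by
  intro W W' _ _ ρ hρ hρ' σ i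
  have h5 : ((5 : ℕ) : ℚ) ≠ 0 := by norm_num
  haveI := module_free_tateModule_holds W 5
  haveI := module_finite_tateModule_holds W 5
  haveI := module_free_tateModule_holds W' 5
  haveI := module_finite_tateModule_holds W' 5
  rw [charpoly_framedTateGaloisRep_eq_map_map W' σ, charpoly_framedTateGaloisRep_eq_map_map W σ,
    Polynomial.coeff_map, Polynomial.coeff_map, Polynomial.coeff_map, Polynomial.coeff_map]
  apply valuation_sub_lt_one_of_toZMod_eq
  rw [← Polynomial.coeff_map, ← Polynomial.coeff_map,
    ← hρ'.charpoly_eq_map_charpoly_galoisRepTate W' 5 h5 σ,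
    ← hρ.charpoly_eq_map_charpoly_galoisRepTate W 5 h5 σ]

/-- **H3a** (PROVED): the determinant of the canonical frame is the cyclotomic character (pushed to
`ℚ̄₅`): `det = (-1)² · charpoly.coeff 0` (`Matrix.det_eq_sign_charpoly_coeff`,
`LinearMap.det_eq_sign_charpoly_coeff`, `finrank_tateModule_eq_two_holds`) and
`det(σ | T₅E) = χ₅(σ)` (`det_galoisRepTate_eq_cyclotomicCharacter_holds`, PROVED in the tree). -/
theorem det_framedTateGaloisRep_eq_cyclotomic (W : WeierstrassCurve ℚ) [W.IsElliptic]
    (σ : absoluteGaloisGroup ℚ) :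
    ((W.framedTateGaloisRep 5 σ : GL (Fin 2) (PadicAlgCl 5)) : Matrix (Fin 2) (Fin 2) (PadicAlgCl 5)).det =
      algebraMap ℚ_[5] (PadicAlgCl 5) (PadicInt.Coe.ringHom (p := 5)
        ((GaloisRep.cyclotomicCharacter ℚ 5 σ : ℤ_[5]ˣ) : ℤ_[5])) := by
  have h5 : ((5 : ℕ) : ℚ) ≠ 0 := by norm_num
  haveI := module_free_tateModule_holds W 5
  haveI := module_finite_tateModule_holds W 5
  rw [Matrix.det_eq_sign_charpoly_coeff]
  have hc : ((W.framedTateGaloisRep 5 σ : GL (Fin 2) (PadicAlgCl 5)) :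
      Matrix (Fin 2) (Fin 2) (PadicAlgCl 5)).charpoly = FramedRep.charpoly (W.framedTateGaloisRep 5) σ := rfl
  rw [hc, charpoly_framedTateGaloisRep_eq_map_map W σ, Polynomial.coeff_map, Polynomial.coeff_map,
    Fintype.card_fin]
  have hdet := LinearMap.det_eq_sign_charpoly_coeff (W.galoisRepTate 5 σ)
  rw [finrank_tateModule_eq_two_holds W 5 h5] at hdet
  rw [← W.det_galoisRepTate_eq_cyclotomicCharacter_holds 5 h5 σ, hdet]
  norm_num

/-- (PROVED) **H3 `DetEqFramedTateFive`.** -/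
theorem detEqFramedTateFive_holds : DetEqFramedTateFive := by
  intro W W' _ _ σ
  rw [det_framedTateGaloisRep_eq_cyclotomic W σ, det_framedTateGaloisRep_eq_cyclotomic W' σ]

/-! ### T2 (gen 9) — EXIT through the rational frame: micro-lemmas O1a, O1d -/

/-- **O1a `JExtendsFive`** (S, OPEN): for a NEWFORM `g` (so `K_g` is a number field,
`numberField_coeffCharField_of_isNewform1`, PROVED) every `j : 𝓞_g → ℤ̄₅` extends to `ι' : K_g → ℚ̄₅`:
`K_g = Frac 𝓞_g` (Mathlib `IsFractionRing (𝓞 K) K`; `coeffCharIntegers g = integralClosure ℤ K_g` is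
`𝓞 K_g` by definition), `ℤ̄₅ ⊆ ℚ̄₅ ∘ j` is injective (its kernel is a prime of `𝓞_g` over `(0)` of `ℤ`
since `ℚ̄₅` has characteristic `0`, hence `⊥`: `Ideal.eq_bot_of_comap_eq_bot`), then
`IsFractionRing.lift`. [folklore] -/
def JExtendsFive : Prop :=
  ∀ {M : ℕ} [NeZero M] (g : CuspForm (Gamma1 M) 2) (j : coeffCharIntegers g →+* padicAlgClIntegers 5),
    IsNewform1 g →
    ∃ ι' : coeffCharField g →+* PadicAlgCl 5,
      (padicAlgClIntegers 5).subtype.comp j = ι'.comp (algebraMap (coeffCharIntegers g) (coeffCharField g))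

/-- **O1d `OutAdapterFive`** (= k1's `OutAdapter 5`, PROVED as `outAdapter_holds` in
`STUB_IDEAS_stub_liftFive_1g6.lean`; to be landed as a Theorems helper): an attachment of the CANONICAL
frame `ρ_{W,5}` to a weight-2 newform gives BCDT condition (4) `IsModularGaloisRepTate`
(`isUnramifiedAt_framedTateGaloisRep_iff`, `galoisRepTate_eq_one_of_rationalGaloisRepTate_eq_one`, H2a,
`map_charpoly_galoisRepTate_eq`). [cite: BCDTJAMS2001, Introduction ((1) ⇒ (4))] -/
def OutAdapterFive : Prop :=
  ∀ (W : WeierstrassCurve ℚ) [W.IsElliptic] {M : ℕ} [NeZero M] (g : CuspForm (Gamma1 M) 2)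
    (ι' : coeffCharField g →+* PadicAlgCl 5),
    IsNewform1 g → IsGaloisRepOfNewform1 g ι' {r | r ∣ M * 5} (W.framedTateGaloisRep 5) →
    W.IsModularGaloisRepTate 5

/-- **O1b** (PROVED): an integral attachment gives a rational attachment of the base change along a
compatible pair `(j, ι')` (`Polynomial.map_map`, `FramedGaloisRep.hasFrobCharpolyAt_baseChange`,
`isUnramifiedAt_baseChange_iff`). [folklore] -/
theorem isGaloisRepOfNewform1_baseChange_of_int (hf : Continuous (padicAlgClIntegers 5).subtype)
    {M : ℕ} [NeZero M] {g : CuspForm (Gamma1 M) 2} {j : coeffCharIntegers g →+* padicAlgClIntegers 5}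
    {ι' : coeffCharField g →+* PadicAlgCl 5} {S : Set ℕ}
    {ρ' : FramedGaloisRep ℚ (padicAlgClIntegers 5) 2}
    (hj : (padicAlgClIntegers 5).subtype.comp j =
      ι'.comp (algebraMap (coeffCharIntegers g) (coeffCharField g)))
    (h : IsGaloisRepOfNewform1Int g j S ρ') :
    IsGaloisRepOfNewform1 g ι' S (FramedRep.baseChange (padicAlgClIntegers 5).subtype hf ρ') := by
  intro v hv
  obtain ⟨hur, Q, hQ, hfrob⟩ := h v hv
  refine ⟨(FramedGaloisRep.isUnramifiedAt_baseChange_iff _ hf Subtype.val_injective v ρ').mpr hur, ?_⟩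
  have hpoly : (Q.map j).map (padicAlgClIntegers 5).subtype =
      (heckePolynomial g (primesEquiv v : Nat.Primes)).map ι' := by
    rw [Polynomial.map_map, hj, ← Polynomial.map_map, hQ]
  rw [← hpoly]
  exact FramedGaloisRep.hasFrobCharpolyAt_baseChange _ hf hfrob

/-- (PROVED, logic) **EXIT from the micro-lemmas**: O1a + O1b (above) + O1c (tree:
`isGaloisRepOfNewform1_conj`, PROVED) + O1d. -/
theorem exitFive_of_micro (ha : JExtendsFive) (hd : OutAdapterFive) : ExitFive := by
  intro W _ hf M _ g j ρ' P hnew hgal hconj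
  obtain ⟨ι', hj⟩ := ha g j hnew
  have h1 := isGaloisRepOfNewform1_baseChange_of_int hf hj hgal
  have h2 := GreenbergSelmer.isGaloisRepOfNewform1_conj P h1
  rw [hconj] at h2
  exact hd W g ι' hnew h2

end Summit.ABC.ABC.Cruxes.FreyModularity.StubIdeas.LiftFive2g9

end
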